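import Mathlib.Analysis.Calculus.MeanValue
import Mathlib.Analysis.Calculus.Deriv.Shift
import Literature.Analysis.FluidPDE.StretchedLayerNS
import HarnessLib

/-!
# Calculus of the slice derivatives `∂ₓ`, `∂_y` of curried plane fields

Analysis/FluidPDE support file (everything proved, no definitions, no named facts): the
elementary calculus of the slice derivatives `StretchedLayer.dX f x y = (d/ds) f s y |_{s = x}`,
`StretchedLayer.dY f x y = (d/ds) f x s |_{s = y}` of `StretchedLayerNS` (Mathlib `deriv` of the
slices of a curried plane field `f : ℝ → ℝ → ℝ`), needed by the `L²` energy method on the period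
strip of the stretched two-dimensional Navier–Stokes layer system
(`StretchedLayerStripCalculus`, `StretchedLayerEnergyRigidity`):

* slice derivatives are the Fréchet derivative of `q ↦ f q.1 q.2` applied to `(1,0)`, `(0,1)`
  (`hasDerivAt_slice_x/y`, `dX_eq_fderiv`, `dY_eq_fderiv`); hence `∂ₓ, ∂_y : Cⁿ⁺¹ → Cⁿ`
  (`contDiff_dX`, `contDiff_dY`), continuity of the first (second) slice derivatives of `C¹`
  (`C²`) fields, and `HasDerivAt` of the slices of `Cⁿ` fields, `n ≠ 0`;
* algebra: translates (`dX_translate`, `dY_translate`), differences, products, and propagation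
  of `x`-periodicity to `∂ₓf`, `∂_yf`;
* two mean-value bounds: the shift bound `|f(x + ℓ) − f(x)| ≤ ℓ sup |f′|` and growth along a
  line from a linearly growing derivative.

All statements are folklore calculus. Compare `ElgindiStripCalculus` (the same dictionary for
Elgindi's operators on the open quarter strip).
-/

noncomputable section

open Set Function Filter
open scoped Topology

namespace Literature.Analysis.FluidPDE

namespace StretchedLayer

/-! ### Slice derivatives versus the Fréchet derivative -/

/-- The `x`-slice of a plane field differentiable at `(x, y)` has derivative `Df(x,y)(1,0)`. [folklore] -/
theorem hasDerivAt_slice_x {f : ℝ → ℝ → ℝ} {x y : ℝ}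
    (hf : DifferentiableAt ℝ (fun q : ℝ × ℝ => f q.1 q.2) (x, y)) :
    HasDerivAt (fun s => f s y) (fderiv ℝ (fun q : ℝ × ℝ => f q.1 q.2) (x, y) (1, 0)) x := by
  have h1 : HasDerivAt (fun s : ℝ => (s, y)) (1, 0) x :=
    (hasDerivAt_id x).prodMk (hasDerivAt_const x y)
  exact hf.hasFDerivAt.comp_hasDerivAt x h1

/-- The `y`-slice of a plane field differentiable at `(x, y)` has derivative `Df(x,y)(0,1)`. [folklore] -/
theorem hasDerivAt_slice_y {f : ℝ → ℝ → ℝ} {x y : ℝ}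
    (hf : DifferentiableAt ℝ (fun q : ℝ × ℝ => f q.1 q.2) (x, y)) :
    HasDerivAt (fun s => f x s) (fderiv ℝ (fun q : ℝ × ℝ => f q.1 q.2) (x, y) (0, 1)) y := by
  have h1 : HasDerivAt (fun s : ℝ => (x, s)) (0, 1) y :=
    (hasDerivAt_const y x).prodMk (hasDerivAt_id y)
  exact hf.hasFDerivAt.comp_hasDerivAt y h1

/-- `∂ₓf(x,y) = Df(x,y)(1,0)` at a point of differentiability. [folklore] -/
theorem dX_eq_fderiv {f : ℝ → ℝ → ℝ} {x y : ℝ}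
    (hf : DifferentiableAt ℝ (fun q : ℝ × ℝ => f q.1 q.2) (x, y)) :
    dX f x y = fderiv ℝ (fun q : ℝ × ℝ => f q.1 q.2) (x, y) (1, 0) :=
  (hasDerivAt_slice_x hf).deriv

/-- `∂_yf(x,y) = Df(x,y)(0,1)` at a point of differentiability. [folklore] -/
theorem dY_eq_fderiv {f : ℝ → ℝ → ℝ} {x y : ℝ}
    (hf : DifferentiableAt ℝ (fun q : ℝ × ℝ => f q.1 q.2) (x, y)) :
    dY f x y = fderiv ℝ (fun q : ℝ × ℝ => f q.1 q.2) (x, y) (0, 1) :=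
  (hasDerivAt_slice_y hf).deriv

/-- The `x`-slice has derivative `∂ₓf` wherever the field is differentiable. [folklore] -/
theorem hasDerivAt_dX {f : ℝ → ℝ → ℝ} {x y : ℝ}
    (hf : DifferentiableAt ℝ (fun q : ℝ × ℝ => f q.1 q.2) (x, y)) :
    HasDerivAt (fun s => f s y) (dX f x y) x :=
  (hasDerivAt_slice_x hf).differentiableAt.hasDerivAt

/-- The `y`-slice has derivative `∂_yf` wherever the field is differentiable. [folklore] -/
theorem hasDerivAt_dY {f : ℝ → ℝ → ℝ} {x y : ℝ}
    (hf : DifferentiableAt ℝ (fun q : ℝ × ℝ => f q.1 q.2) (x, y)) :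
    HasDerivAt (fun s => f x s) (dY f x y) y :=
  (hasDerivAt_slice_y hf).differentiableAt.hasDerivAt

/-- Slices of a `Cⁿ` field, `n ≠ 0`, have derivative `∂ₓf` everywhere. [folklore] -/
theorem hasDerivAt_dX_of_contDiff {f : ℝ → ℝ → ℝ} {n : WithTop ℕ∞}
    (hf : ContDiff ℝ n (fun q : ℝ × ℝ => f q.1 q.2)) (hn : n ≠ 0) (x y : ℝ) :
    HasDerivAt (fun s => f s y) (dX f x y) x :=
  hasDerivAt_dX (hf.differentiable hn _)

/-- Slices of a `Cⁿ` field, `n ≠ 0`, have derivative `∂_yf` everywhere. [folklore] -/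
theorem hasDerivAt_dY_of_contDiff {f : ℝ → ℝ → ℝ} {n : WithTop ℕ∞}
    (hf : ContDiff ℝ n (fun q : ℝ × ℝ => f q.1 q.2)) (hn : n ≠ 0) (x y : ℝ) :
    HasDerivAt (fun s => f x s) (dY f x y) y :=
  hasDerivAt_dY (hf.differentiable hn _)

/-- `∂ₓ` maps `Cⁿ⁺¹` plane fields to `Cⁿ` plane fields. [folklore] -/
theorem contDiff_dX {f : ℝ → ℝ → ℝ} {n : WithTop ℕ∞}
    (hf : ContDiff ℝ (n + 1) (fun q : ℝ × ℝ => f q.1 q.2)) :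
    ContDiff ℝ n (fun q : ℝ × ℝ => dX f q.1 q.2) := by
  have h1 : ContDiff ℝ n (fun p => fderiv ℝ (fun q : ℝ × ℝ => f q.1 q.2) p (1, 0)) :=
    (hf.fderiv_right le_rfl).clm_apply contDiff_const
  have h2 : (fun q : ℝ × ℝ => dX f q.1 q.2) =
      fun p => fderiv ℝ (fun q : ℝ × ℝ => f q.1 q.2) p (1, 0) :=
    funext fun p => dX_eq_fderiv (hf.differentiable (by simp) p)
  rw [h2]
  exact h1

/-- `∂_y` maps `Cⁿ⁺¹` plane fields to `Cⁿ` plane fields. [folklore] -/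
theorem contDiff_dY {f : ℝ → ℝ → ℝ} {n : WithTop ℕ∞}
    (hf : ContDiff ℝ (n + 1) (fun q : ℝ × ℝ => f q.1 q.2)) :
    ContDiff ℝ n (fun q : ℝ × ℝ => dY f q.1 q.2) := by
  have h1 : ContDiff ℝ n (fun p => fderiv ℝ (fun q : ℝ × ℝ => f q.1 q.2) p (0, 1)) :=
    (hf.fderiv_right le_rfl).clm_apply contDiff_const
  have h2 : (fun q : ℝ × ℝ => dY f q.1 q.2) =
      fun p => fderiv ℝ (fun q : ℝ × ℝ => f q.1 q.2) p (0, 1) :=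
    funext fun p => dY_eq_fderiv (hf.differentiable (by simp) p)
  rw [h2]
  exact h1

/-- `∂ₓ` of a `C²` field is `C¹`. [folklore] -/
theorem contDiff_one_dX {f : ℝ → ℝ → ℝ} (hf : ContDiff ℝ 2 (fun q : ℝ × ℝ => f q.1 q.2)) :
    ContDiff ℝ 1 (fun q : ℝ × ℝ => dX f q.1 q.2) :=
  contDiff_dX (by rw [one_add_one_eq_two]; exact hf)

/-- `∂_y` of a `C²` field is `C¹`. [folklore] -/
theorem contDiff_one_dY {f : ℝ → ℝ → ℝ} (hf : ContDiff ℝ 2 (fun q : ℝ × ℝ => f q.1 q.2)) :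
    ContDiff ℝ 1 (fun q : ℝ × ℝ => dY f q.1 q.2) :=
  contDiff_dY (by rw [one_add_one_eq_two]; exact hf)

/-- `∂ₓ` of a `C¹` field is continuous. [folklore] -/
theorem continuous_dX {f : ℝ → ℝ → ℝ} (hf : ContDiff ℝ 1 (fun q : ℝ × ℝ => f q.1 q.2)) :
    Continuous (fun q : ℝ × ℝ => dX f q.1 q.2) :=
  (contDiff_dX (n := 0) (by rw [zero_add]; exact hf)).continuous

/-- `∂_y` of a `C¹` field is continuous. [folklore] -/
theorem continuous_dY {f : ℝ → ℝ → ℝ} (hf : ContDiff ℝ 1 (fun q : ℝ × ℝ => f q.1 q.2)) :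
    Continuous (fun q : ℝ × ℝ => dY f q.1 q.2) :=
  (contDiff_dY (n := 0) (by rw [zero_add]; exact hf)).continuous

/-- `∂ₓ∂ₓ` of a `C²` field is continuous. [folklore] -/
theorem continuous_dXdX {f : ℝ → ℝ → ℝ} (hf : ContDiff ℝ 2 (fun q : ℝ × ℝ => f q.1 q.2)) :
    Continuous (fun q : ℝ × ℝ => dX (dX f) q.1 q.2) :=
  continuous_dX (contDiff_one_dX hf)

/-- `∂_y∂_y` of a `C²` field is continuous. [folklore] -/
theorem continuous_dYdY {f : ℝ → ℝ → ℝ} (hf : ContDiff ℝ 2 (fun q : ℝ × ℝ => f q.1 q.2)) :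
    Continuous (fun q : ℝ × ℝ => dY (dY f) q.1 q.2) :=
  continuous_dY (contDiff_one_dY hf)

/-- Slices `x ↦ f x y` of a continuous plane field are continuous. [folklore] -/
theorem continuous_slice_x {f : ℝ → ℝ → ℝ} (hf : Continuous (fun q : ℝ × ℝ => f q.1 q.2))
    (y : ℝ) : Continuous fun x => f x y :=
  hf.comp (continuous_id.prodMk continuous_const)

/-- Slices `y ↦ f x y` of a continuous plane field are continuous. [folklore] -/
theorem continuous_slice_y {f : ℝ → ℝ → ℝ} (hf : Continuous (fun q : ℝ × ℝ => f q.1 q.2))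
    (x : ℝ) : Continuous fun y => f x y :=
  hf.comp (continuous_const.prodMk continuous_id)

/-! ### Translates, differences, products, periodicity -/

/-- `∂ₓ` commutes with `x`-translation (no differentiability needed). [folklore] -/
theorem dX_translate (f : ℝ → ℝ → ℝ) (ℓ x y : ℝ) :
    dX (fun a b => f (a + ℓ) b) x y = dX f (x + ℓ) y :=
  deriv_comp_add_const (fun s => f s y) ℓ x

/-- `∂_y` commutes with `x`-translation (definitionally). [folklore] -/
theorem dY_translate (f : ℝ → ℝ → ℝ) (ℓ x y : ℝ) :
    dY (fun a b => f (a + ℓ) b) x y = dY f (x + ℓ) y := rfl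

/-- `∂ₓ` commutes with `x`-translation, as functions. [folklore] -/
theorem dX_translate_fun (f : ℝ → ℝ → ℝ) (ℓ : ℝ) :
    dX (fun a b => f (a + ℓ) b) = fun x y => dX f (x + ℓ) y :=
  funext fun x => funext fun y => dX_translate f ℓ x y

/-- `∂_y` commutes with `x`-translation, as functions. [folklore] -/
theorem dY_translate_fun (f : ℝ → ℝ → ℝ) (ℓ : ℝ) :
    dY (fun a b => f (a + ℓ) b) = fun x y => dY f (x + ℓ) y := rfl

/-- `∂ₓ(f − g) = ∂ₓf − ∂ₓg` where both slices are differentiable. [folklore] -/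
theorem dX_sub {f g : ℝ → ℝ → ℝ} {x y : ℝ} (hf : DifferentiableAt ℝ (fun s => f s y) x)
    (hg : DifferentiableAt ℝ (fun s => g s y) x) :
    dX (fun a b => f a b - g a b) x y = dX f x y - dX g x y :=
  deriv_fun_sub hf hg

/-- `∂_y(f − g) = ∂_yf − ∂_yg` where both slices are differentiable. [folklore] -/
theorem dY_sub {f g : ℝ → ℝ → ℝ} {x y : ℝ} (hf : DifferentiableAt ℝ (fun s => f x s) y)
    (hg : DifferentiableAt ℝ (fun s => g x s) y) :
    dY (fun a b => f a b - g a b) x y = dY f x y - dY g x y :=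
  deriv_fun_sub hf hg

/-- `∂ₓ(f − g) = ∂ₓf − ∂ₓg` as functions, for fields with differentiable `x`-slices. [folklore] -/
theorem dX_sub_fun {f g : ℝ → ℝ → ℝ} (hf : ∀ x y, DifferentiableAt ℝ (fun s => f s y) x)
    (hg : ∀ x y, DifferentiableAt ℝ (fun s => g s y) x) :
    dX (fun a b => f a b - g a b) = fun x y => dX f x y - dX g x y :=
  funext fun x => funext fun y => dX_sub (hf x y) (hg x y)

/-- `∂_y(f − g) = ∂_yf − ∂_yg` as functions, for fields with differentiable `y`-slices. [folklore] -/
theorem dY_sub_fun {f g : ℝ → ℝ → ℝ} (hf : ∀ x y, DifferentiableAt ℝ (fun s => f x s) y)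
    (hg : ∀ x y, DifferentiableAt ℝ (fun s => g x s) y) :
    dY (fun a b => f a b - g a b) = fun x y => dY f x y - dY g x y :=
  funext fun x => funext fun y => dY_sub (hf x y) (hg x y)

/-- `∂ₓ(fg)` by the product rule where both slices are differentiable. [folklore] -/
theorem dX_mul {f g : ℝ → ℝ → ℝ} {x y : ℝ} (hf : DifferentiableAt ℝ (fun s => f s y) x)
    (hg : DifferentiableAt ℝ (fun s => g s y) x) :
    dX (fun a b => f a b * g a b) x y = dX f x y * g x y + f x y * dX g x y :=
  deriv_fun_mul hf hg

/-- `∂_y(fg)` by the product rule where both slices are differentiable. [folklore] -/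
theorem dY_mul {f g : ℝ → ℝ → ℝ} {x y : ℝ} (hf : DifferentiableAt ℝ (fun s => f x s) y)
    (hg : DifferentiableAt ℝ (fun s => g x s) y) :
    dY (fun a b => f a b * g a b) x y = dY f x y * g x y + f x y * dY g x y :=
  deriv_fun_mul hf hg

/-- `x`-periodicity passes to `∂ₓf` (no differentiability needed). [folklore] -/
theorem dX_periodic {f : ℝ → ℝ → ℝ} {L : ℝ} (h : ∀ x y, f (x + L) y = f x y) (x y : ℝ) :
    dX f (x + L) y = dX f x y := by
  have e : (fun s => f (s + L) y) = fun s => f s y := funext fun s => h s y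
  rw [dX, dX, ← deriv_comp_add_const (fun s => f s y) L x, e]

/-- `x`-periodicity passes to `∂_yf`. [folklore] -/
theorem dY_periodic {f : ℝ → ℝ → ℝ} {L : ℝ} (h : ∀ x y, f (x + L) y = f x y) (x y : ℝ) :
    dY f (x + L) y = dY f x y := by
  have e : (fun s => f (x + L) s) = fun s => f x s := funext fun s => h x s
  rw [dY, dY, e]

/-! ### Two mean-value bounds -/

/-- **Shift bound**: `|f(x + ℓ) − f(x)| ≤ M ℓ` when `|f′| ≤ M` (`ℓ ≥ 0`, `f` differentiable).
[folklore] -/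
theorem abs_sub_shift_le {f : ℝ → ℝ} (hf : Differentiable ℝ f) {M ℓ : ℝ} (hℓ : 0 ≤ ℓ)
    (hM : ∀ s, |deriv f s| ≤ M) (x : ℝ) : |f (x + ℓ) - f x| ≤ M * ℓ := by
  have h := convex_univ.norm_image_sub_le_of_norm_deriv_le (f := f) (C := M) (x := x) (y := x + ℓ)
    (fun s _ => hf s) (fun s _ => by rw [Real.norm_eq_abs]; exact hM s) (mem_univ _) (mem_univ _)
  rw [Real.norm_eq_abs, Real.norm_eq_abs, add_sub_cancel_left, abs_of_nonneg hℓ] at h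
  exact h

/-- **Growth along a line from a linearly growing derivative**: if `|g′(s)| ≤ C (1 + |s|)` for all
`s` then `|g(y) − g(0)| ≤ C (1 + |y|) |y|`. [folklore] -/
theorem abs_sub_zero_le_of_abs_deriv_le {g : ℝ → ℝ} (hg : Differentiable ℝ g) {C : ℝ}
    (hC : ∀ s, |deriv g s| ≤ C * (1 + |s|)) (y : ℝ) : |g y - g 0| ≤ C * (1 + |y|) * |y| := by
  have h := (convex_uIcc 0 y).norm_image_sub_le_of_norm_deriv_le (f := g) (C := C * (1 + |y|))
    (x := 0) (y := y) (fun s _ => hg s) (fun s hs => ?_) left_mem_uIcc right_mem_uIcc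
  · rw [Real.norm_eq_abs, Real.norm_eq_abs, sub_zero] at h
    exact h
  · rw [Real.norm_eq_abs]
    refine (hC s).trans ?_
    have hC0 : 0 ≤ C := by
      have h0 := (abs_nonneg _).trans (hC 0)
      rw [abs_zero, add_zero, mul_one] at h0
      exact h0
    have hs' : |s| ≤ |y| := by
      rcases mem_uIcc.1 hs with ⟨h0, h1⟩ | ⟨h0, h1⟩
      · rw [abs_of_nonneg h0]; exact h1.trans (le_abs_self y)
      · rw [abs_of_nonpos h1, abs_of_nonpos (h0.trans h1)]; linarith
    nlinarith

/-- **Bound on a period gives a bound everywhere**: an `L`-periodic function (`L > 0`) bounded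
by `M` on `[0, L]` is bounded by `M`. [folklore] -/
theorem abs_le_of_periodic {g : ℝ → ℝ} {L M : ℝ} (hL : 0 < L) (hper : ∀ x, g (x + L) = g x)
    (hM : ∀ x ∈ Icc 0 L, |g x| ≤ M) (x : ℝ) : |g x| ≤ M := by
  obtain ⟨x', hx', hgx⟩ := Function.Periodic.exists_mem_Ico₀ hper hL x
  rw [hgx]
  exact hM x' (Ico_subset_Icc_self hx')

/-- A continuous `L`-periodic function (`L > 0`) is bounded. [folklore] -/
theorem exists_abs_le_of_periodic {g : ℝ → ℝ} {L : ℝ} (hL : 0 < L) (hg : Continuous g)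
    (hper : ∀ x, g (x + L) = g x) : ∃ M, ∀ x, |g x| ≤ M := by
  obtain ⟨M, hM⟩ := isCompact_Icc.exists_bound_of_continuousOn (f := g) (s := Icc 0 L)
    hg.continuousOn
  exact ⟨M, abs_le_of_periodic hL hper (fun x hx => by rw [← Real.norm_eq_abs]; exact hM x hx)⟩

end StretchedLayer

end Literature.Analysis.FluidPDE
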